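import Literature.MathematicalPhysics.QuantumFieldTheory.ConformalBootstrap3D.PointKernelK34L505Data

/-!
# K34L505 certificate, closed-box extension: the `ε`-row sliver `[19/20, 38927/40960)`

Segment table `esegsXK34L505` (2 segments, 2 interval-rule cells on `s`-covers with
16 pieces, `n_F ≤ 27`) of the second lower-box instance `[101/200, 51/100] × [19/20, 38927/40960)`
of the certificate of `PointKernelK34L505Data`; its union with the landed box `[3/5, 19/20)` covers the CLOSED
box `[0.6, 0.95]` of `IsingEnclosureGlobal.GlobalCertificates.lower_0505_0510`.  Pure data. [folklore]
-/

set_option maxRecDepth 100000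
set_option maxHeartbeats 0

namespace Literature.MathematicalPhysics.QuantumFieldTheory.ConformalBootstrap3D.PointKernelK34L505X

open Literature.MathematicalPhysics.QuantumFieldTheory.ConformalBootstrap3D.PointKernel Literature.MathematicalPhysics.QuantumFieldTheory.ConformalBootstrap3D.PointKernelK34L505

/-- the sliver's `ε`-row segments `(ℓ = 0, r₀, steps, n_F's, rule bits)` (interval rule, cells on the 16-piece `s`-cover). [folklore] -/
def esegsXK34L505 : List HSeg := [
  ⟨0, ⟨0, 0, 21, 1, 4, 1⟩, ([12] : List ℕ), ([27] : List ℕ), ([true] : List Bool)⟩,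
  ⟨0, ⟨0, 0, 21, 1, 12, 257⟩, ([13] : List ℕ), ([27] : List ℕ), ([true] : List Bool)⟩]
/-- Legendre-table depth for the sliver cells (`max n_F`). [folklore] -/
def JEXK34L505 : ℕ := 27

end Literature.MathematicalPhysics.QuantumFieldTheory.ConformalBootstrap3D.PointKernelK34L505X
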